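import Summits.MatrixMultiplication.OmegaCensus.STPPKernelListerDefs

/-!
# ω-census (abelian STPP census): kernel lister — soundness of the SEARCH, abstract form (kernel)

HONEST FRAMING (pub-omega census; verbatim): lottery ticket; floor = certified bounds/negative ranges.
Census STRUCTURE (seat pub-omega-stpp-2 gen 29, 2026-08-29), family (b2).  Nothing here is progress on `ω`.

The depth-first search of `STPPKernelListerDefs.lean` (`addOne` / `scanS` / `scanC` / `scanFirstS` / `scanFirstC`) is proved sound here RELATIVE TO an abstract
«bad pattern» predicate `Bad : List Shape → Prop` (in the sibling file: realised by an STPP family of the group, beating and minimal), an abstract state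
invariant `Inv : St → List Shape → Prop` (later: the state is the one computed from the pattern) and an abstract coverage predicate
`Cov : List ℕ → List Shape → Prop` (later: the packed rows satisfy the knapsack certificate for these shapes), packaged with the facts the search relies on
(`SearchHyp`).  Extensions are COUNT VECTORS IN LIST ORDER (`OrdExt R E`: `E` arises from the remaining shape list `R` by replacing each shape by a number
of copies).  Results: `addOne_sound`, `scanS_sound`, `scanC_sound`, `scanFirstS_sound`, `scanFirstC_sound` — the last says: `scanFirstC n dead sel L = true` ⇒
no bad pattern in list order over the shapes of `L` whose first block satisfies `sel`.  Pure logic about a finite program; the STPP content (discharging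
`SearchHyp`) is separate.
-/

namespace Summit.MatrixMultiplication.OmegaCensus.KLister

/-! ## Count-vector extensions in list order -/

/-- `OrdExt R E`: the list `E` is obtained from `R` by replacing every element by some number (possibly zero) of copies, in order. [folklore] -/
inductive OrdExt : List Shape → List Shape → Prop
  | nil : OrdExt [] []
  | skip {r : Shape} {R E : List Shape} : OrdExt R E → OrdExt (r :: R) E
  | take {r : Shape} {R E : List Shape} : OrdExt (r :: R) E → OrdExt (r :: R) (r :: E)

/-- An extension of the empty list is empty. [folklore] -/
theorem OrdExt.eq_nil {E : List Shape} (h : OrdExt [] E) : E = [] := by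
  cases h; rfl

/-- Case analysis at a cons: either no copy of the head is used, or the extension starts with the head. [folklore] -/
theorem OrdExt.cons_cases {r : Shape} {R E : List Shape} (h : OrdExt (r :: R) E) :
    OrdExt R E ∨ ∃ E', E = r :: E' ∧ OrdExt (r :: R) E' := by
  cases h with
  | skip h => exact Or.inl h
  | take h => exact Or.inr ⟨_, rfl, h⟩

/-- The flattened shape list of a chunk list. [folklore] -/
def flat (L : List (List ℕ × List Shape)) : List Shape := L.flatMap fun ch => ch.2

/-- `flat` of a cons. [folklore] -/
theorem flat_cons (rows : List ℕ) (ss : List Shape) (L : List (List ℕ × List Shape)) : flat ((rows, ss) :: L) = ss ++ flat L := by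
  simp [flat]

/-! ## The abstract hypotheses -/

/-- The facts about `Bad` / `Inv` / `Cov` the search relies on (all discharged from STPP theorems in the sibling file). [folklore] -/
structure SearchHyp (n : ℕ) (dead : List (List Shape)) (Bad : List Shape → Prop) (Inv : St → List Shape → Prop)
    (Cov : List ℕ → List Shape → Prop) : Prop where
  /-- a non-beating pattern is not bad -/
  nonbeating : ∀ st P, Inv st P → st.vol ≤ n → ¬ Bad P
  /-- a shape that does not fit a monotone budget kills every extension through it -/
  misfit : ∀ st P s E', Inv st P → st.fits n s = false → ¬ Bad (P ++ s :: E')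
  /-- overshooting the minimality margin kills every extension through it -/
  overshoot : ∀ st P s E', Inv st P → n + min st.mm (minprod s) < st.vol + svol s → ¬ Bad (P ++ s :: E')
  /-- an exhausted `Σab` budget kills every proper extension -/
  exhausted : ∀ st P s E', Inv st P → n ≤ st.sab → ¬ Bad (P ++ s :: E')
  /-- a beating pattern passing `leafOK` is not bad -/
  leaf : ∀ st P, Inv st P → n < st.vol → leafOK n dead st P = true → ¬ Bad P
  /-- a proper extension of a beating pattern is not bad (not minimal) -/
  prefix_beating : ∀ st P E', Inv st P → n < st.vol → E' ≠ [] → ¬ Bad (P ++ E')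
  /-- the pruning bound: rows covering the remaining shapes bound the volume of every extension -/
  prune : ∀ st P rows R E, Inv st P → Cov rows R → OrdExt R E → st.vol + bound n st rows ≤ n → ¬ Bad (P ++ E)
  /-- the invariant is preserved by adding a fitting shape, and `Σab` grows -/
  add : ∀ st P s, Inv st P → st.fits n s = true → Inv (st.add n s) (P ++ [s]) ∧ st.sab + 1 ≤ (st.add n s).sab
  /-- coverage is inherited by dropping leading shapes -/
  cov_tail : ∀ rows s R, Cov rows (s :: R) → Cov rows R

/-- Specification of a continuation `k` for the remaining shape list `R`: whenever it answers `true` on a non-beating invariant state, no bad extension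
over `R` exists. [folklore] -/
def KSpec (n : ℕ) (Bad : List Shape → Prop) (Inv : St → List Shape → Prop) (k : St → List Shape → Bool) (R : List Shape) : Prop :=
  ∀ st P, Inv st P → st.vol ≤ n → k st P = true → ∀ E, OrdExt R E → ¬ Bad (P ++ E)

variable {n : ℕ} {dead : List (List Shape)} {Bad : List Shape → Prop} {Inv : St → List Shape → Prop} {Cov : List ℕ → List Shape → Prop}

/-! ## `addOne` -/

/-- **Soundness of `addOne`.**  If the continuation `k` is sound for `R`, then `addOne n dead k s fuel st P = true` (with the fuel invariant `n ≤ fuel + Σab`)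
excludes every bad extension of `P` that starts with a copy of `s` and continues with copies of `s` and then shapes of `R`. [folklore] -/
theorem addOne_sound (H : SearchHyp n dead Bad Inv Cov) {k : St → List Shape → Bool} {R : List Shape} {s : Shape} (hk : KSpec n Bad Inv k R) :
    ∀ (fuel : ℕ) (st : St) (P : List Shape), Inv st P → n ≤ fuel + st.sab → addOne n dead k s fuel st P = true →
      ∀ E', OrdExt (s :: R) E' → ¬ Bad (P ++ s :: E') := by
  intro fuel
  induction fuel with
  | zero =>
    intro st P hI hf _ E' _
    exact H.exhausted st P s E' hI (by simpa using hf)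
  | succ fuel ih =>
    intro st P hI hf h E' hE'
    rw [addOne] at h
    cases hfit : st.fits n s with
    | false => exact H.misfit st P s E' hI hfit
    | true =>
      rw [hfit] at h
      simp only [Bool.not_true, Bool.false_or, Bool.or_eq_true] at h
      rcases h with h | h
      · exact H.overshoot st P s E' hI (by simpa [Nat.blt_eq] using h)
      · obtain ⟨hI', hsab⟩ := H.add st P s hI hfit
        by_cases hb : n < (st.add n s).vol
        · rw [if_pos hb] at h
          by_cases hE : E' = []
          · subst hE
            exact H.leaf _ _ hI' hb h
          · have := H.prefix_beating _ _ E' hI' hb hE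
            simpa [List.append_assoc] using this
        · rw [if_neg hb, Bool.and_eq_true] at h
          obtain ⟨hk0, hrec⟩ := h
          have hvol : (st.add n s).vol ≤ n := Nat.le_of_not_lt hb
          rcases hE'.cons_cases with hR | ⟨E'', rfl, hE''⟩
          · have := hk _ _ hI' hvol hk0 E' hR
            simpa [List.append_assoc] using this
          · have hf' : n ≤ fuel + (st.add n s).sab := by omega
            have := ih (st.add n s) (P ++ [s]) hI' hf' hrec E'' hE''
            simpa [List.append_assoc] using this

/-! ## `scanS`, `scanC` -/

/-- **Soundness of `scanS`** (one chunk, then the continuation). [folklore] -/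
theorem scanS_sound (H : SearchHyp n dead Bad Inv Cov) {rows : List ℕ} {kAfter : St → List Shape → Bool} {Rafter : List Shape}
    (hk : KSpec n Bad Inv kAfter Rafter) :
    ∀ ss : List Shape, Cov rows (ss ++ Rafter) → KSpec n Bad Inv (scanS n dead rows kAfter ss) (ss ++ Rafter) := by
  intro ss
  induction ss with
  | nil =>
    intro _ st P hI hv h E hE
    exact hk st P hI hv (by simpa [scanS] using h) E (by simpa using hE)
  | cons s ss ih =>
    intro hcov st P hI hv h E hE
    rw [scanS, Bool.or_eq_true] at h
    rcases h with hpr | h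
    · exact H.prune st P rows (s :: ss ++ Rafter) E hI hcov (by simpa using hE) (by simpa [Nat.ble_eq] using hpr)
    · rw [Bool.and_eq_true] at h
      obtain ⟨h0, h1⟩ := h
      have hcov' : Cov rows (ss ++ Rafter) := H.cov_tail rows s _ (by simpa using hcov)
      have hks : KSpec n Bad Inv (scanS n dead rows kAfter ss) (ss ++ Rafter) := ih hcov'
      have hE' : OrdExt (s :: (ss ++ Rafter)) E := by simpa using hE
      rcases hE'.cons_cases with hR | ⟨E', rfl, hE''⟩
      · exact hks st P hI hv h0 E hR
      · have hsab : st.sab ≥ 0 := Nat.zero_le _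
        exact addOne_sound H hks n st P hI (by omega) h1 E' hE''

/-- Coverage of a chunk list: chunk `i`'s rows cover the shapes of chunks `≥ i`. [folklore] -/
def ChunksCov (Cov : List ℕ → List Shape → Prop) : List (List ℕ × List Shape) → Prop
  | [] => True
  | (rows, ss) :: rest => Cov rows (ss ++ flat rest) ∧ ChunksCov Cov rest

/-- **Soundness of `scanC`.** [folklore] -/
theorem scanC_sound (H : SearchHyp n dead Bad Inv Cov) :
    ∀ L : List (List ℕ × List Shape), ChunksCov Cov L → KSpec n Bad Inv (scanC n dead L) (flat L) := by
  intro L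
  induction L with
  | nil =>
    intro _ st P hI hv _ E hE
    have hE0 : E = [] := OrdExt.eq_nil (by simpa [flat] using hE)
    subst hE0
    simpa using H.nonbeating st P hI hv
  | cons ch rest ih =>
    obtain ⟨rows, ss⟩ := ch
    intro hc st P hI hv h E hE
    rw [ChunksCov] at hc
    rw [flat_cons] at hE
    exact scanS_sound H (ih hc.2) ss hc.1 st P hI hv (by simpa [scanC] using h) E hE

/-! ## The root: `scanFirstS`, `scanFirstC` -/

/-- **Soundness of `scanFirstS`.**  With a sound continuation for `Rafter` and a sound «later first blocks» fact for `Rafter`, `scanFirstS … ss = true` excludes every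
bad NON-EMPTY pattern in list order over `ss ++ Rafter` whose first block satisfies `sel`. [folklore] -/
theorem scanFirstS_sound (H : SearchHyp n dead Bad Inv Cov) (hinit : Inv (St.init n) []) {sel : Shape → Bool} {rows : List ℕ}
    {kAfter : St → List Shape → Bool} {Rafter : List Shape} (hk : KSpec n Bad Inv kAfter Rafter)
    (hlater : ∀ E, OrdExt Rafter E → ∀ s E', E = s :: E' → sel s = true → ¬ Bad E) :
    ∀ ss : List Shape, Cov rows (ss ++ Rafter) → scanFirstS n dead sel rows kAfter ss = true →
      ∀ E, OrdExt (ss ++ Rafter) E → ∀ s E', E = s :: E' → sel s = true → ¬ Bad E := by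
  intro ss
  induction ss with
  | nil =>
    intro _ _ E hE s E' hEs hsel
    exact hlater E (by simpa using hE) s E' hEs hsel
  | cons t ss ih =>
    intro hcov h E hE s E' hEs hsel
    rw [scanFirstS, Bool.and_eq_true] at h
    obtain ⟨h0, h1⟩ := h
    have hcov' : Cov rows (ss ++ Rafter) := H.cov_tail rows t _ (by simpa using hcov)
    have hE' : OrdExt (t :: (ss ++ Rafter)) E := by simpa using hE
    rcases hE'.cons_cases with hR | ⟨E'', hEE, hE''⟩
    · exact ih hcov' h1 E hR s E' hEs hsel
    · -- `E = t :: E''` and `E = s :: E'` ⇒ `t = s`, `E'' = E'`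
      subst hEs
      obtain ⟨hst, hEq⟩ := List.cons.inj hEE
      subst hst
      subst hEq
      rw [hsel] at h0
      simp only [Bool.not_true, Bool.false_or] at h0
      have hks : KSpec n Bad Inv (scanS n dead rows kAfter ss) (ss ++ Rafter) := scanS_sound H hk ss hcov'
      have hsab : (St.init n).sab = 0 := rfl
      have := addOne_sound H hks n (St.init n) [] hinit (by rw [hsab]; omega) h0 E' hE''
      simpa using this

/-- **Soundness of `scanFirstC`.** [folklore] -/
theorem scanFirstC_sound (H : SearchHyp n dead Bad Inv Cov) (hinit : Inv (St.init n) []) {sel : Shape → Bool} :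
    ∀ L : List (List ℕ × List Shape), ChunksCov Cov L → scanFirstC n dead sel L = true →
      ∀ E, OrdExt (flat L) E → ∀ s E', E = s :: E' → sel s = true → ¬ Bad E := by
  intro L
  induction L with
  | nil =>
    intro _ _ E hE s E' hEs _
    have : E = [] := OrdExt.eq_nil (by simpa [flat] using hE)
    rw [this] at hEs; exact absurd hEs (by simp)
  | cons ch rest ih =>
    obtain ⟨rows, ss⟩ := ch
    intro hc h E hE s E' hEs hsel
    rw [ChunksCov] at hc
    rw [scanFirstC, Bool.and_eq_true] at h
    rw [flat_cons] at hE
    exact scanFirstS_sound H hinit (scanC_sound H rest hc.2) (ih hc.2 h.2) ss hc.1 h.1 E hE s E' hEs hsel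

/-! ## Relativised form: hypotheses only for shapes of a universe `U`

The concrete instantiation (sibling file) can only discharge the shape-wise hypotheses for ADMISSIBLE shapes (entries `≥ 1`, so that `Σab` grows with every
copy); since every shape the search ever touches lies in the scanned list, it suffices to assume them on a universe `U ⊇` the scanned shapes. -/

/-- `SearchHyp` with the shape-wise facts assumed only for `s ∈ U`. [folklore] -/
structure SearchHypU (n : ℕ) (dead : List (List Shape)) (U : List Shape) (Bad : List Shape → Prop) (Inv : St → List Shape → Prop)
    (Cov : List ℕ → List Shape → Prop) : Prop where
  /-- a non-beating pattern is not bad -/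
  nonbeating : ∀ st P, Inv st P → st.vol ≤ n → ¬ Bad P
  /-- a shape that does not fit a monotone budget kills every extension through it -/
  misfit : ∀ st P s E', s ∈ U → Inv st P → st.fits n s = false → ¬ Bad (P ++ s :: E')
  /-- overshooting the minimality margin kills every extension through it -/
  overshoot : ∀ st P s E', s ∈ U → Inv st P → n + min st.mm (minprod s) < st.vol + svol s → ¬ Bad (P ++ s :: E')
  /-- an exhausted `Σab` budget kills every proper extension -/
  exhausted : ∀ st P s E', s ∈ U → Inv st P → n ≤ st.sab → ¬ Bad (P ++ s :: E')
  /-- a beating pattern passing `leafOK` is not bad -/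
  leaf : ∀ st P, Inv st P → n < st.vol → leafOK n dead st P = true → ¬ Bad P
  /-- a proper extension of a beating pattern is not bad (not minimal) -/
  prefix_beating : ∀ st P E', Inv st P → n < st.vol → E' ≠ [] → ¬ Bad (P ++ E')
  /-- the pruning bound: rows covering the remaining shapes bound the volume of every extension -/
  prune : ∀ st P rows R E, Inv st P → Cov rows R → OrdExt R E → st.vol + bound n st rows ≤ n → ¬ Bad (P ++ E)
  /-- the invariant is preserved by adding a fitting shape of `U`, and `Σab` grows -/
  add : ∀ st P s, s ∈ U → Inv st P → st.fits n s = true → Inv (st.add n s) (P ++ [s]) ∧ st.sab + 1 ≤ (st.add n s).sab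
  /-- coverage is inherited by dropping leading shapes -/
  cov_tail : ∀ rows s R, Cov rows (s :: R) → Cov rows R

variable {U : List Shape}

/-- **Soundness of `addOne`, relativised.** [folklore] -/
theorem addOne_soundU (H : SearchHypU n dead U Bad Inv Cov) {k : St → List Shape → Bool} {R : List Shape} {s : Shape} (hs : s ∈ U)
    (hk : KSpec n Bad Inv k R) :
    ∀ (fuel : ℕ) (st : St) (P : List Shape), Inv st P → n ≤ fuel + st.sab → addOne n dead k s fuel st P = true →
      ∀ E', OrdExt (s :: R) E' → ¬ Bad (P ++ s :: E') := by
  intro fuel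
  induction fuel with
  | zero =>
    intro st P hI hf _ E' _
    exact H.exhausted st P s E' hs hI (by simpa using hf)
  | succ fuel ih =>
    intro st P hI hf h E' hE'
    rw [addOne] at h
    cases hfit : st.fits n s with
    | false => exact H.misfit st P s E' hs hI hfit
    | true =>
      rw [hfit] at h
      simp only [Bool.not_true, Bool.false_or, Bool.or_eq_true] at h
      rcases h with h | h
      · exact H.overshoot st P s E' hs hI (by simpa [Nat.blt_eq] using h)
      · obtain ⟨hI', hsab⟩ := H.add st P s hs hI hfit
        by_cases hb : n < (st.add n s).vol
        · rw [if_pos hb] at h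
          by_cases hE : E' = []
          · subst hE
            exact H.leaf _ _ hI' hb h
          · have := H.prefix_beating _ _ E' hI' hb hE
            simpa [List.append_assoc] using this
        · rw [if_neg hb, Bool.and_eq_true] at h
          obtain ⟨hk0, hrec⟩ := h
          have hvol : (st.add n s).vol ≤ n := Nat.le_of_not_lt hb
          rcases hE'.cons_cases with hR | ⟨E'', rfl, hE''⟩
          · have := hk _ _ hI' hvol hk0 E' hR
            simpa [List.append_assoc] using this
          · have hf' : n ≤ fuel + (st.add n s).sab := by omega
            have := ih (st.add n s) (P ++ [s]) hI' hf' hrec E'' hE''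
            simpa [List.append_assoc] using this

/-- **Soundness of `scanS`, relativised** (all shapes of the chunk in `U`). [folklore] -/
theorem scanS_soundU (H : SearchHypU n dead U Bad Inv Cov) {rows : List ℕ} {kAfter : St → List Shape → Bool} {Rafter : List Shape}
    (hk : KSpec n Bad Inv kAfter Rafter) :
    ∀ ss : List Shape, (∀ x ∈ ss, x ∈ U) → Cov rows (ss ++ Rafter) → KSpec n Bad Inv (scanS n dead rows kAfter ss) (ss ++ Rafter) := by
  intro ss
  induction ss with
  | nil =>
    intro _ _ st P hI hv h E hE
    exact hk st P hI hv (by simpa [scanS] using h) E (by simpa using hE)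
  | cons s ss ih =>
    intro hU hcov st P hI hv h E hE
    rw [scanS, Bool.or_eq_true] at h
    rcases h with hpr | h
    · exact H.prune st P rows (s :: ss ++ Rafter) E hI hcov (by simpa using hE) (by simpa [Nat.ble_eq] using hpr)
    · rw [Bool.and_eq_true] at h
      obtain ⟨h0, h1⟩ := h
      have hcov' : Cov rows (ss ++ Rafter) := H.cov_tail rows s _ (by simpa using hcov)
      have hks : KSpec n Bad Inv (scanS n dead rows kAfter ss) (ss ++ Rafter) := ih (fun x hx => hU x (List.mem_cons_of_mem _ hx)) hcov'
      have hE' : OrdExt (s :: (ss ++ Rafter)) E := by simpa using hE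
      rcases hE'.cons_cases with hR | ⟨E', rfl, hE''⟩
      · exact hks st P hI hv h0 E hR
      · exact addOne_soundU H (hU s List.mem_cons_self) hks n st P hI (by omega) h1 E' hE''

/-- **Soundness of `scanC`, relativised** (all shapes of the chunk list in `U`). [folklore] -/
theorem scanC_soundU (H : SearchHypU n dead U Bad Inv Cov) :
    ∀ L : List (List ℕ × List Shape), (∀ x ∈ flat L, x ∈ U) → ChunksCov Cov L → KSpec n Bad Inv (scanC n dead L) (flat L) := by
  intro L
  induction L with
  | nil =>
    intro _ _ st P hI hv _ E hE
    have hE0 : E = [] := OrdExt.eq_nil (by simpa [flat] using hE)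
    subst hE0
    simpa using H.nonbeating st P hI hv
  | cons ch rest ih =>
    obtain ⟨rows, ss⟩ := ch
    intro hU hc st P hI hv h E hE
    rw [ChunksCov] at hc
    rw [flat_cons] at hE hU
    exact scanS_soundU H (ih (fun x hx => hU x (List.mem_append_right _ hx)) hc.2) ss
      (fun x hx => hU x (List.mem_append_left _ hx)) hc.1 st P hI hv (by simpa [scanC] using h) E hE

/-- **Soundness of `scanFirstS`, relativised.** [folklore] -/
theorem scanFirstS_soundU (H : SearchHypU n dead U Bad Inv Cov) (hinit : Inv (St.init n) []) {sel : Shape → Bool} {rows : List ℕ}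
    {kAfter : St → List Shape → Bool} {Rafter : List Shape} (hk : KSpec n Bad Inv kAfter Rafter)
    (hlater : ∀ E, OrdExt Rafter E → ∀ s E', E = s :: E' → sel s = true → ¬ Bad E) :
    ∀ ss : List Shape, (∀ x ∈ ss, x ∈ U) → Cov rows (ss ++ Rafter) → scanFirstS n dead sel rows kAfter ss = true →
      ∀ E, OrdExt (ss ++ Rafter) E → ∀ s E', E = s :: E' → sel s = true → ¬ Bad E := by
  intro ss
  induction ss with
  | nil =>
    intro _ _ _ E hE s E' hEs hsel
    exact hlater E (by simpa using hE) s E' hEs hsel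
  | cons t ss ih =>
    intro hU hcov h E hE s E' hEs hsel
    rw [scanFirstS, Bool.and_eq_true] at h
    obtain ⟨h0, h1⟩ := h
    have hcov' : Cov rows (ss ++ Rafter) := H.cov_tail rows t _ (by simpa using hcov)
    have hU' : ∀ x ∈ ss, x ∈ U := fun x hx => hU x (List.mem_cons_of_mem _ hx)
    have hE' : OrdExt (t :: (ss ++ Rafter)) E := by simpa using hE
    rcases hE'.cons_cases with hR | ⟨E'', hEE, hE''⟩
    · exact ih hU' hcov' h1 E hR s E' hEs hsel
    · subst hEs
      obtain ⟨hst, hEq⟩ := List.cons.inj hEE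
      subst hst
      subst hEq
      rw [hsel] at h0
      simp only [Bool.not_true, Bool.false_or] at h0
      have hks : KSpec n Bad Inv (scanS n dead rows kAfter ss) (ss ++ Rafter) := scanS_soundU H hk ss hU' hcov'
      have hsab : (St.init n).sab = 0 := rfl
      have := addOne_soundU H (hU s List.mem_cons_self) hks n (St.init n) [] hinit (by rw [hsab]; omega) h0 E' hE''
      simpa using this

/-- **Soundness of `scanFirstC`, relativised**: with every shape of `L` in `U`, `scanFirstC n dead sel L = true` excludes every bad NON-EMPTY pattern in
list order over the shapes of `L` whose first block satisfies `sel`. [folklore] -/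
theorem scanFirstC_soundU (H : SearchHypU n dead U Bad Inv Cov) (hinit : Inv (St.init n) []) {sel : Shape → Bool} :
    ∀ L : List (List ℕ × List Shape), (∀ x ∈ flat L, x ∈ U) → ChunksCov Cov L → scanFirstC n dead sel L = true →
      ∀ E, OrdExt (flat L) E → ∀ s E', E = s :: E' → sel s = true → ¬ Bad E := by
  intro L
  induction L with
  | nil =>
    intro _ _ _ E hE s E' hEs _
    have : E = [] := OrdExt.eq_nil (by simpa [flat] using hE)
    rw [this] at hEs; exact absurd hEs (by simp)
  | cons ch rest ih =>
    obtain ⟨rows, ss⟩ := ch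
    intro hU hc h E hE s E' hEs hsel
    rw [ChunksCov] at hc
    rw [scanFirstC, Bool.and_eq_true] at h
    rw [flat_cons] at hE hU
    have hUr : ∀ x ∈ flat rest, x ∈ U := fun x hx => hU x (List.mem_append_right _ hx)
    exact scanFirstS_soundU H hinit (scanC_soundU H rest hUr hc.2) (ih hUr hc.2 h.2) ss (fun x hx => hU x (List.mem_append_left _ hx))
      hc.1 h.1 E hE s E' hEs hsel

end Summit.MatrixMultiplication.OmegaCensus.KLister
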